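import Literature.Computability.QuantumComplexity.LightConeSim
import HarnessLib

/-!
# The state-vector simulator of a light cone: the initial state and the read-out

Continuation of `LightConeSim.lean` (functional model of the polynomial-time simulator of the
light cone of a measured wire; discharge of `Literature.Barriers.QuantumAdvantage.markovShi2008_cor15_anyOrder`,
Markov–Shi 2008, Cor. 1.5, decision form):

* `splitOn i st`, **`initState S base`** — the sparse basis state `|base⟩` on the labels of the
  cone of the wire list `S` (every wire of `S` doubles the stored labels; the amplitude `1` stays
  on `base`), and `represents_initState`: it satisfies the invariant `Represents` for the start of
  the simulation (`S` without duplicates); `length_initState`: `2^{|S|}` entries;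
* `sums st = (A, B)` — the integers `Σ_{y₀ = 1} A(a_y)`, `Σ_{y₀ = 1} B(a_y)` over the stored
  entries, and **`Represents.two_pow_mul_probAcc`**: `2^h · Pr[wire 0 reads 1] = A + ε √2 B`
  (`ε = 1` for `ζ = ω`, `ε = -1` for the conjugate `ζ = ω⁵`).

The decision (the integer test `W = 10A + 14B − 5·2^h` on these sums and its sign under a
`(2/3, 1/3)` gap) is in the sequel `LightConeDecision.lean`. Relation to `StateVectorDP.lean`
(`accU`/`accV`/`two_pow_mul_probAcc` over `ZW = Fin 4 → ℤ` function tables on an explicit label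
list, machine layer `ConeSimStep.lean`): the same mathematics for a different data layout — here
association lists `List (QReg N × Amp)` keyed by labels, generated by doubling along the cone
wires, which is the layout the brick-algebra machine of `LightConeMachine*.lean` folds over.

## References

* M. A. Nielsen, I. L. Chuang, *Quantum Computation and Quantum Information*, CUP 2010, §4.5.5 and
  Box 4.1 (classical simulation by tracking all amplitudes), §2.2.5 (Born rule).
-/

noncomputable section

namespace Literature.Computability.QuantumComplexity

open _root_.Computability Complexity Cryptography Matrix

namespace LightCone

variable {N : ℕ}

/-! ### The initial sparse state -/

/-- One step of the doubling of the stored labels along the wire `i`: the entry `(y, a)` spawns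
`(y[i↦1], ·)` and `(y[i↦0], ·)`, the coordinates `a` staying on the copy equal to `y` and `0` going
to the other. [folklore] -/
def splitStep (i : Fin N) (out : List (QReg N × Amp)) (p : QReg N × Amp) : List (QReg N × Amp) :=
  (Function.update p.1 i true, if p.1 i = true then p.2 else 0) ::
    (Function.update p.1 i false, if p.1 i = true then 0 else p.2) :: out

/-- Doubling the stored labels along the wire `i` (by pushing, so the list comes out reversed and
interleaved). [folklore] -/
def splitOn (i : Fin N) (st : List (QReg N × Amp)) : List (QReg N × Amp) := st.foldl (splitStep i) []

/-- **The initial sparse state**: the basis state `|base⟩` stored on all labels of the cone of the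
wire list `S` around `base` (doubling along the wires of `S` in turn, from `[(base, 1)]`).
(Nielsen–Chuang 2010, Box 4.1.) [folklore] -/
def initState (S : List (Fin N)) (base : QReg N) : List (QReg N × Amp) :=
  S.foldl (fun st i => splitOn i st) [(base, 1)]

/-- Pushing two images per item onto an accumulator. [folklore] -/
theorem foldl_cons_cons_eq {α β : Type*} (f g : α → β) :
    ∀ (l : List α) (acc : List β),
      l.foldl (fun out a => f a :: g a :: out) acc = (l.flatMap fun a => [g a, f a]).reverse ++ acc
  | [], acc => by simp
  | a :: l, acc => by
    rw [List.foldl_cons, foldl_cons_cons_eq f g l, List.flatMap_cons, List.reverse_append]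
    simp

/-- The entry of `splitOn` for the bit `b`. [folklore] -/
def splitEntry (i : Fin N) (b : Bool) (p : QReg N × Amp) : QReg N × Amp :=
  (Function.update p.1 i b, if p.1 i = b then p.2 else 0)

/-- `splitOn` as a reversed `flatMap`. [folklore] -/
theorem splitOn_eq (i : Fin N) (st : List (QReg N × Amp)) :
    splitOn i st = (st.flatMap fun p => [splitEntry i false p, splitEntry i true p]).reverse := by
  have h := foldl_cons_cons_eq (fun p : QReg N × Amp => splitEntry i true p) (fun p => splitEntry i false p) st []
  rw [List.append_nil] at h
  rw [← h, splitOn]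
  congr 1
  funext out p
  simp only [splitStep, splitEntry]
  cases p.1 i <;> simp

/-- The entries of `splitOn`. [folklore] -/
theorem mem_splitOn_iff (i : Fin N) (st : List (QReg N × Amp)) (q : QReg N × Amp) :
    q ∈ splitOn i st ↔ ∃ p ∈ st, q = splitEntry i false p ∨ q = splitEntry i true p := by
  rw [splitOn_eq, List.mem_reverse, List.mem_flatMap]
  simp only [List.mem_cons, List.not_mem_nil, or_false]

/-- The keys of `splitOn`. [folklore] -/
theorem map_fst_splitOn (i : Fin N) (st : List (QReg N × Amp)) :
    (splitOn i st).map Prod.fst =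
      ((st.map Prod.fst).flatMap fun y => [Function.update y i false, Function.update y i true]).reverse := by
  rw [splitOn_eq, List.map_reverse, List.map_flatMap, List.flatMap_map]
  rfl

/-- The invariant of the initial doubling: duplicate-free keys, keys = the cone of the wires
processed so far, coordinates `[y = base]`. [folklore] -/
structure InitInv (T : Finset (Fin N)) (base : QReg N) (st : List (QReg N × Amp)) : Prop where
  /-- no label is stored twice -/
  nodup : (st.map Prod.fst).Nodup
  /-- the stored labels are the labels of the cone -/
  mem_iff : ∀ y, y ∈ st.map Prod.fst ↔ InCone T base y
  /-- the coordinates are those of `|base⟩` -/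
  val : ∀ p ∈ st, p.2 = if p.1 = base then 1 else 0

/-- The start of the doubling: `[(base, 1)]` for the empty wire set. [folklore] -/
theorem initInv_singleton (base : QReg N) : InitInv ∅ base [(base, 1)] := by
  refine ⟨by simp, fun y => ?_, fun p hp => ?_⟩
  · simp only [List.map_cons, List.map_nil, List.mem_singleton, InCone, Finset.notMem_empty,
      not_false_eq_true, forall_const]
    exact ⟨fun h => by subst h; intro; rfl, fun h => funext h⟩
  · simp only [List.mem_singleton] at hp
    subst hp; simp

/-- **One doubling step preserves the invariant** (for a fresh wire `i ∉ T`). [folklore] -/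
theorem InitInv.splitOn {T : Finset (Fin N)} {base : QReg N} {st : List (QReg N × Amp)}
    (hI : InitInv T base st) {i : Fin N} (hi : i ∉ T) : InitInv (insert i T) base (splitOn i st) := by
  classical
  have hbase : ∀ p ∈ st, p.1 i = base i := fun p hp =>
    (hI.mem_iff p.1).1 (List.mem_map.2 ⟨p, hp, rfl⟩) i hi
  refine ⟨?_, fun y => ?_, fun q hq => ?_⟩
  · -- duplicate-free keys
    rw [map_fst_splitOn, List.nodup_reverse, List.nodup_flatMap]
    constructor
    · intro y _
      have : Function.update y i false ≠ Function.update y i true := fun h => by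
        have := congrFun h i; simp at this
      simp [this]
    · have hpw : (st.map Prod.fst).Pairwise (fun a b => a ≠ b) := hI.nodup
      refine List.Pairwise.imp_of_mem (fun {a b} ha hb hab => ?_) hpw
      obtain ⟨p, hp, rfl⟩ := List.mem_map.1 ha
      obtain ⟨q, hq, rfl⟩ := List.mem_map.1 hb
      have hpq : p.1 i = q.1 i := by rw [hbase p hp, hbase q hq]
      simp only [List.disjoint_cons_left, List.mem_cons, List.not_mem_nil, or_false,
        List.disjoint_nil_left, and_true, not_or]
      have key : ∀ b b', Function.update p.1 i b ≠ Function.update q.1 i b' := fun b b' h => hab (by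
        funext l
        by_cases hl : l = i
        · subst hl; exact hpq
        · have := congrFun h l
          rwa [Function.update_of_ne hl, Function.update_of_ne hl] at this)
      exact ⟨⟨key _ _, key _ _⟩, key _ _, key _ _⟩
  · -- the keys are the cone of `insert i T`
    rw [map_fst_splitOn, List.mem_reverse, List.mem_flatMap]
    simp only [List.mem_cons, List.not_mem_nil, or_false]
    constructor
    · rintro ⟨y', hy', hy⟩
      have hc : InCone T base y' := (hI.mem_iff y').1 hy'
      have hc' : InCone (insert i T) base y' := fun l hl => hc l fun h => hl (Finset.mem_insert_of_mem h)
      rcases hy with rfl | rfl <;>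
        exact (inCone_update_iff (Finset.mem_insert_self i T) y' _).2 hc'
    · intro hy
      refine ⟨Function.update y i (base i), (hI.mem_iff _).2 fun l hl => ?_, ?_⟩
      · by_cases hli : l = i
        · subst hli; simp
        · rw [Function.update_of_ne hli]
          exact hy l fun h => by
            rcases Finset.mem_insert.1 h with h | h
            · exact hli h
            · exact hl h
      · cases hyi : y i
        · left; rw [Function.update_idem, ← hyi, Function.update_eq_self]
        · right; rw [Function.update_idem, ← hyi, Function.update_eq_self]
  · -- the coordinates
    obtain ⟨p, hp, hq⟩ := (mem_splitOn_iff i st q).1 hq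
    have hpv := hI.val p hp
    have hpb := hbase p hp
    rcases hq with rfl | rfl
    · simp only [splitEntry]
      cases hpi : p.1 i
      · have h1 : Function.update p.1 i false = p.1 := Function.update_eq_self_iff.2 hpi.symm
        simp [h1, hpv]
      · have hne : Function.update p.1 i false ≠ base := fun h => by
          have := congrFun h i; rw [Function.update_self, ← hpb, hpi] at this; exact absurd this (by decide)
        simp [hne]
    · simp only [splitEntry]
      cases hpi : p.1 i
      · have hne : Function.update p.1 i true ≠ base := fun h => by
          have := congrFun h i; rw [Function.update_self, ← hpb, hpi] at this; exact absurd this (by decide)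
        simp [hne]
      · have h1 : Function.update p.1 i true = p.1 := Function.update_eq_self_iff.2 hpi.symm
        simp [h1, hpv]

/-- The doubling along a fresh duplicate-free wire list. [folklore] -/
theorem InitInv.foldl_splitOn {base : QReg N} :
    ∀ (S : List (Fin N)) {T : Finset (Fin N)} {st : List (QReg N × Amp)},
      InitInv T base st → (∀ i ∈ S, i ∉ T) → S.Nodup →
      InitInv (T ∪ S.toFinset) base (S.foldl (fun st i => LightCone.splitOn i st) st)
  | [], T, st, hI, _, _ => by simpa using hI
  | i :: S, T, st, hI, hfresh, hnd => by
    classical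
    rw [List.nodup_cons] at hnd
    have h1 := hI.splitOn (hfresh i List.mem_cons_self)
    have h2 := InitInv.foldl_splitOn S h1 (fun j hj hjT => by
      rcases Finset.mem_insert.1 hjT with rfl | hjT
      · exact hnd.1 hj
      · exact hfresh j (List.mem_cons_of_mem i hj) hjT) hnd.2
    have hset : T ∪ (i :: S).toFinset = insert i T ∪ S.toFinset := by
      ext l
      simp only [Finset.mem_union, List.toFinset_cons, Finset.mem_insert, List.mem_toFinset]
      tauto
    rw [List.foldl_cons, hset]
    exact h2

/-- **The initial state represents `|base⟩`** on the cone of a duplicate-free wire list, with no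
Hadamard factor, for every `ζ`. (Nielsen–Chuang 2010, Box 4.1.) [folklore] -/
theorem represents_initState (ζ : ℂ) {S : List (Fin N)} (hS : S.Nodup) (base : QReg N) :
    Represents ζ S.toFinset base 0 (initState S base) (basisState base) := by
  classical
  have hI : InitInv S.toFinset base (initState S base) := by
    simpa [initState] using InitInv.foldl_splitOn S (initInv_singleton base) (fun i _ => Finset.notMem_empty i) hS
  refine ⟨hI.nodup, hI.mem_iff, fun p hp => ?_, fun y hy => ?_⟩
  · rw [hI.val p hp, basisState_apply, pow_zero, one_mul]
    split_ifs <;> simp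
  · rw [basisState_apply, if_neg]
    rintro rfl
    exact hy fun _ _ => rfl

/-- The number of stored entries doubles with each wire. [folklore] -/
theorem length_splitOn (i : Fin N) (st : List (QReg N × Amp)) : (splitOn i st).length = 2 * st.length := by
  rw [splitOn_eq, List.length_reverse, List.length_flatMap]
  simp only [List.length_cons, List.length_nil]
  induction st with
  | nil => rfl
  | cons p st ih => simp only [List.map_cons, List.sum_cons, ih, List.length_cons]; ring

/-- **The initial state has `2^{|S|}` entries.** [folklore] -/
theorem length_initState (S : List (Fin N)) (base : QReg N) : (initState S base).length = 2 ^ S.length := by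
  suffices h : ∀ (st : List (QReg N × Amp)),
      (S.foldl (fun st i => splitOn i st) st).length = 2 ^ S.length * st.length by
    simpa [initState] using h [(base, 1)]
  induction S with
  | nil => intro st; simp
  | cons i S ih => intro st; rw [List.foldl_cons, ih, length_splitOn, List.length_cons, pow_succ]; ring

/-! ### The read-out -/

/-- Wire `0` of a label (`false` on the empty register). [folklore] -/
def wire0 (y : QReg N) : Bool := if h : 0 < N then y ⟨0, h⟩ else false

/-- **The read-out sums** `(A, B) = (Σ_{y₀=1} A(a_y), Σ_{y₀=1} B(a_y))` over the stored entries.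
[folklore] -/
def sums (st : List (QReg N × Amp)) : ℤ × ℤ :=
  st.foldl (fun AB p => if wire0 p.1 = true then (AB.1 + p.2.normA, AB.2 + p.2.normB) else AB) (0, 0)

/-- The read-out sums as sums over the list. [folklore] -/
theorem sums_eq (st : List (QReg N × Amp)) :
    sums st = ((st.map fun p => if wire0 p.1 = true then p.2.normA else 0).sum,
      (st.map fun p => if wire0 p.1 = true then p.2.normB else 0).sum) := by
  suffices h : ∀ (A B : ℤ), st.foldl (fun AB p => if wire0 p.1 = true then (AB.1 + p.2.normA, AB.2 + p.2.normB) else AB) (A, B) =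
      (A + (st.map fun p => if wire0 p.1 = true then p.2.normA else 0).sum,
        B + (st.map fun p => if wire0 p.1 = true then p.2.normB else 0).sum) by
    unfold sums; simpa using h 0 0
  induction st with
  | nil => intro A B; simp
  | cons p st ih =>
    intro A B
    rw [List.foldl_cons]
    by_cases hp : wire0 p.1 = true
    · rw [if_pos hp, ih]; simp [hp, add_assoc]
    · rw [if_neg hp, ih]; simp [hp]

/-- **`2^h · Pr[wire 0 reads 1] = A + ε √2 B`** for a represented vector, given the norm identity
`‖eval ζ a‖² = A(a) + ε √2 B(a)` of the semantics (`ε = ±1` for `ζ = ω, ω⁵`, `LightConeAmp.lean`).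
(Nielsen–Chuang 2010, §2.2.5 with Box 4.1.) [folklore] -/
theorem Represents.two_pow_mul_probAcc {ζ : ℂ} {S : Finset (Fin N)} {base : QReg N} {h : ℕ}
    {st : List (QReg N × Amp)} {v : QReg N → ℂ} (hr : Represents ζ S base h st v) (hN : 0 < N)
    {ε : ℝ} (hnorm : ∀ a : Amp, ‖Amp.eval ζ a‖ ^ 2 = a.normA + ε * Real.sqrt 2 * a.normB) :
    (2 : ℝ) ^ h * ∑ z : QReg N, (if z ⟨0, hN⟩ = true then ‖v z‖ ^ 2 else 0) =
      ((sums st).1 : ℝ) + ε * Real.sqrt 2 * (sums st).2 := by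
  classical
  set f : QReg N → ℝ := fun z => if z ⟨0, hN⟩ = true then ‖v z‖ ^ 2 else 0 with hf
  have hsub : ∑ z : QReg N, f z = ∑ z ∈ (st.map Prod.fst).toFinset, f z := by
    refine (Finset.sum_subset (Finset.subset_univ _) fun z _ hz => ?_).symm
    have hz' : z ∉ st.map Prod.fst := fun h' => hz (List.mem_toFinset.2 h')
    have : v z = 0 := hr.zero z fun hc => hz' ((hr.mem_iff z).2 hc)
    simp [hf, this]
  rw [hsub, List.sum_toFinset _ hr.nodup, List.map_map, sums_eq]
  dsimp only
  rw [Int.cast_list_sum, Int.cast_list_sum, List.map_map, List.map_map, ← List.sum_map_mul_left,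
    ← List.sum_map_mul_left, ← List.sum_map_add]
  congr 1
  refine List.map_congr_left fun p hp => ?_
  have hw : wire0 p.1 = p.1 ⟨0, hN⟩ := by simp [wire0, hN]
  simp only [Function.comp_apply, hf, hw]
  by_cases hb : p.1 ⟨0, hN⟩ = true
  · rw [if_pos hb, if_pos hb, if_pos hb, hr.val p hp, norm_mul, mul_pow, norm_invSqrt2_pow_sq, hnorm,
      ← mul_assoc, ← mul_pow, show (2 : ℝ) * (1 / 2) = 1 by norm_num, one_pow, one_mul]
  · rw [if_neg hb, if_neg hb, if_neg hb]; push_cast; ring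

end LightCone

end Literature.Computability.QuantumComplexity

end
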